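import Literature.AnabelianGeometry.EtaleTheta.Discharge.Sec1ThetaOrbitModelChi
import Literature.AnabelianGeometry.EtaleTheta.Discharge.Sec1Thm110ModelChiNV
import Literature.AnabelianGeometry.EtaleTheta.Discharge.Sec1Thm110iUniqueSchemaCriterion
import HarnessLib

/-!
# [EtTh] Thm. 1.10 (i), uniqueness clause (F-0513 `Thm110iUnique`): INSTANCE PROVED, NON-VACUOUSLY, at the
# ANCHORED Def. 1.9 datum of the Kummer-carrying χ-model `MuTwoSetting.modelχ` (PROOF-ONLY)

S. Mochizuki, *The étale theta function and its Frobenioid-theoretic manifestations*, Publ. RIMS **45** (2009)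
[EtTh], §1, Def. 1.9 / Thm. 1.10 (i), PRIMS PDF p. 29 (printed 255) [cite: MochizukiEtTh2009, Thm 1.10 (i) p.29]:
"being of standard type … determines this collection of classes up to multiplication by ±1". Layer L2 of the abc-iut
cell, block F tranche 113 (seat abc-iut-f-113 gen 3; FACT-LIST row F-0513), R78 cluster hand F8 — the POSITIVE twin of
`Discharge/Sec1Thm110ClosuresModelChi` (where the ∀-closure of F-0513 over FREE `StandardData` is refuted at the same
model). PROOF-ONLY over this seat's orbit lemma `Discharge/Sec1ThetaOrbitModelChi` (`thetaOrbit_testClass`,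
`evalAt_testClass`, `valuesAt_eq_singleton_of_thetaOrbit_eq`) and F8 `SettingModelChiMuTwo` (`MuTwoSetting.modelχ`,
`epsZχ`), abc-iut-w5-d140's K2-NV file `Discharge/Sec1Thm110ModelChiNV` (`anchoredStandardDataχ`, `tauχ`, `tauInvχ`,
`sqrtNegOneUnitχ`, `sqrtNegOneInvUnitχ`, `sqrtNegOneχ_sq`, `etaleThetaDataχM` — the ANCHORED Def. 1.9 datum
`τ := anchoredPointχ (√−1)`, `τ⁻¹ := anchoredPointχ (√−1)⁻¹` of abc-iut-L2-t6's F7b), and the gen-2 criterion of this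
base `MuTwoSetting.isOfStandardType_iff_exists_minimal` (p433898) — all consumed BY NAME; no `def`, no instance.

RESULT. For `p ≡ 1 (mod 4)`, `ε_Z := a`, and EVERY unit `c ∈ K̈^×`, with the test class
`η̈_c := infl κ̈(c) · infl log(Ü) ∈ H¹(Π^tp_Ÿ, Δ_Θ)` playing `η̈^Θ` (`E := etaleThetaDataχM η̈_c`):
* `valuesAt_testClass_anchored_tau/_tauInv` — the standard sets of values at the ANCHORED `τ^{±1}` are the singletons
  `{c·√−1}`, `{c·(√−1)⁻¹}` (singleton `η̈^{Θ,Z}`-orbit at stage 1 + L2-t6's anchor `log(Ü)|_y = Ü(y)`);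
* **`thm110iUnique_modelχ_anchored`** — `Thm110iUnique (modelχ_compat) (modelχ_isAdmissibleEpsZ) E
  (anchoredStandardDataχ hp η̈_c).toStandardData` HOLDS: `(u·η̈_c) = η̈_{u·c}`, so «`η̈_c` standard ∧ `(u·η̈_c)` standard»
  reads `c·√−1 = ±1 ∧ u·c·√−1 = ±1` up to the sign `(√−1)⁻¹ = −√−1`, whence `u = ±1`;
* `isOfStandardType_testClass_anchored` — NON-VACUITY: for `c := (√−1)⁻¹` the class `η̈_c` IS of standard type (value
  `1` at `τ`); headline `MuTwoSetting.exists_kummer_model_thm110iUnique`.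
So at the Kummer-carrying model the typed F-0513 is PINNED: **TRUE at the anchored Def. 1.9 datum** (this file; K2's
r8″ route via Prop. 1.5 (iii) is unavailable at stage 1, where Prop. 1.5 (iii) fails — abc-iut-L2-t12), **FALSE as a
universal closure over free `StandardData`** (`not_forall_thm110iUnique`, p441915).

HONEST FRAMING: SEMI-SYNTHETIC model, test classes `η̈_c` (not the genuine theta class `etaDdχ`, whose deck orbit is
not a singleton); consistency / non-vacuity evidence for OUR typed interface only; nothing of [EtTh] is asserted;
typed ≠ proved; no side is taken on [IUTchIII] Cor. 3.12 or on any author.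
-/

noncomputable section

namespace Literature.AnabelianGeometry.EtaleTheta.SettingModel

open Literature.AnabelianGeometry.SemiGraphs _root_.Function

variable (p : ℕ) [Fact p.Prime]

/-! ### The test classes `η̈_c` and their unit translates -/

/-- **`(u·η̈_c) = η̈_{u·c}`**: translating the test class by the Kummer class of a unit changes its parameter
(`κ̈`, `kumYdd`, `infl` are homomorphisms). [cite: MochizukiEtTh2009, Thm 1.10 (i) p.29] -/
theorem kumInfl_mul_testClass (u c : (↥(ThetaSetting.modelχ p).Kdd)ˣ) :
    (ThetaSetting.modelχ p).inflTheta (ThetaSetting.modelχ p).GtpYdd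
          ((kummerDataχSec p).kumYdd ((kummerDataχSec p).toKddHat u)) *
        ((ThetaSetting.modelχ p).inflTheta (ThetaSetting.modelχ p).GtpYdd
            ((kummerDataχSec p).kumYdd ((kummerDataχSec p).toKddHat c)) *
          (ThetaSetting.modelχ p).inflTheta (ThetaSetting.modelχ p).GtpYdd (kummerDataχSec p).logUdd) =
      (ThetaSetting.modelχ p).inflTheta (ThetaSetting.modelχ p).GtpYdd
          ((kummerDataχSec p).kumYdd ((kummerDataχSec p).toKddHat (u * c))) *
        (ThetaSetting.modelχ p).inflTheta (ThetaSetting.modelχ p).GtpYdd (kummerDataχSec p).logUdd := by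
  rw [← mul_assoc, ← map_mul ((ThetaSetting.modelχ p).inflTheta (ThetaSetting.modelχ p).GtpYdd),
    ← map_mul (kummerDataχSec p).kumYdd, ← map_mul (kummerDataχSec p).toKddHat]

/-! ### The standard sets of values of `η̈_c` at the ANCHORED `τ`, `τ⁻¹` of the χ-model -/

/-- **`V(η̈_c, τ) = {c·√−1}`** at the anchored `τ := anchoredPointχ (√−1)` of abc-iut-w5-d140's `anchoredStandardDataχ`.
[cite: MochizukiEtTh2009, Def 1.9 (i) p.29] -/
theorem valuesAt_testClass_anchored_tau (hp : p % 4 = 1)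
    (η : (ThetaSetting.modelχ p).H1 (ThetaSetting.modelχ p).GtpYdd) (c : (↥(ThetaSetting.modelχ p).Kdd)ˣ) :
    MuTwoSetting.valuesAt (M := MuTwoSetting.modelχ p) (MuTwoSetting.modelχ_compat p) (epsZχ p)
        ((ThetaSetting.modelχ p).inflTheta (ThetaSetting.modelχ p).GtpYdd
            ((kummerDataχSec p).kumYdd ((kummerDataχSec p).toKddHat c)) *
          (ThetaSetting.modelχ p).inflTheta (ThetaSetting.modelχ p).GtpYdd (kummerDataχSec p).logUdd)
        (anchoredStandardDataχ p hp η).toStandardData.tau =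
      {c * sqrtNegOneUnitχ p hp} :=
  valuesAt_eq_singleton_of_thetaOrbit_eq p _ _ (thetaOrbit_testClass p _ c) _ (evalAt_testClass p (tauχ p hp) c)

/-- **`V(η̈_c, τ⁻¹) = {c·(√−1)⁻¹}`** at the anchored `τ⁻¹ := anchoredPointχ (√−1)⁻¹`. [cite: MochizukiEtTh2009, Def 1.9 (i) p.29] -/
theorem valuesAt_testClass_anchored_tauInv (hp : p % 4 = 1)
    (η : (ThetaSetting.modelχ p).H1 (ThetaSetting.modelχ p).GtpYdd) (c : (↥(ThetaSetting.modelχ p).Kdd)ˣ) :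
    MuTwoSetting.valuesAt (M := MuTwoSetting.modelχ p) (MuTwoSetting.modelχ_compat p) (epsZχ p)
        ((ThetaSetting.modelχ p).inflTheta (ThetaSetting.modelχ p).GtpYdd
            ((kummerDataχSec p).kumYdd ((kummerDataχSec p).toKddHat c)) *
          (ThetaSetting.modelχ p).inflTheta (ThetaSetting.modelχ p).GtpYdd (kummerDataχSec p).logUdd)
        (anchoredStandardDataχ p hp η).toStandardData.tauInv =
      {c * sqrtNegOneInvUnitχ p hp} :=
  valuesAt_eq_singleton_of_thetaOrbit_eq p _ _ (thetaOrbit_testClass p _ c) _ (evalAt_testClass p (tauInvχ p hp) c)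

/-- `(√−1)⁻¹ = −√−1` in `ℚ̄_p`. [cite: MochizukiEtTh2009, Def 1.9 p.29] -/
theorem sqrtNegOneχ_inv (hp : p % 4 = 1) : (sqrtNegOneχ p hp)⁻¹ = -sqrtNegOneχ p hp := by
  have h2 := sqrtNegOneχ_sq p hp
  exact inv_eq_of_mul_eq_one_right (by linear_combination -h2)

/-- The minimal-value predicate of the gen-2 criterion, READ at the anchored datum for the test class `η̈_c`:
«`±1` is a minimal value of `η̈_c^{Θ,Z}` at `τ` or `τ⁻¹`» iff `c·√−1 = ±1` (the `τ⁻¹`-value is `−c·√−1`).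
[cite: MochizukiEtTh2009, Def 1.9 (ii) p.29] -/
theorem exists_minimal_testClass_anchored_iff (hp : p % 4 = 1)
    (η : (ThetaSetting.modelχ p).H1 (ThetaSetting.modelχ p).GtpYdd) (c : (↥(ThetaSetting.modelχ p).Kdd)ˣ) :
    (∃ y : ThetaSetting.NonCuspidalPoint (etaleThetaDataχM p η).toKummerData,
        (y = (anchoredStandardDataχ p hp η).toStandardData.tau ∨ y = (anchoredStandardDataχ p hp η).toStandardData.tauInv) ∧
        ∃ m ∈ MuTwoSetting.valuesAt (M := MuTwoSetting.modelχ p) (MuTwoSetting.modelχ_compat p) (epsZχ p)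
            ((ThetaSetting.modelχ p).inflTheta (ThetaSetting.modelχ p).GtpYdd
                ((kummerDataχSec p).kumYdd ((kummerDataχSec p).toKddHat c)) *
              (ThetaSetting.modelχ p).inflTheta (ThetaSetting.modelχ p).GtpYdd (kummerDataχSec p).logUdd) y,
          (∀ w ∈ MuTwoSetting.valuesAt (M := MuTwoSetting.modelχ p) (MuTwoSetting.modelχ_compat p) (epsZχ p)
              ((ThetaSetting.modelχ p).inflTheta (ThetaSetting.modelχ p).GtpYdd
                  ((kummerDataχSec p).kumYdd ((kummerDataχSec p).toKddHat c)) *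
                (ThetaSetting.modelχ p).inflTheta (ThetaSetting.modelχ p).GtpYdd (kummerDataχSec p).logUdd) y,
              ‖((m : (ThetaSetting.modelχ p).Kdd) : PadicAlgCl p)‖ ≤ ‖((w : (ThetaSetting.modelχ p).Kdd) : PadicAlgCl p)‖) ∧
          (((m : (ThetaSetting.modelχ p).Kdd) : PadicAlgCl p) = 1 ∨ ((m : (ThetaSetting.modelχ p).Kdd) : PadicAlgCl p) = -1)) ↔
      ((c : (ThetaSetting.modelχ p).Kdd) : PadicAlgCl p) * sqrtNegOneχ p hp = 1 ∨
        ((c : (ThetaSetting.modelχ p).Kdd) : PadicAlgCl p) * sqrtNegOneχ p hp = -1 := by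
  have hcoe : (((c * sqrtNegOneUnitχ p hp : (↥(ThetaSetting.modelχ p).Kdd)ˣ) : (ThetaSetting.modelχ p).Kdd) :
      PadicAlgCl p) = ((c : (ThetaSetting.modelχ p).Kdd) : PadicAlgCl p) * sqrtNegOneχ p hp := by
    push_cast; rw [coe_sqrtNegOneUnitχ]
  have hcoe' : (((c * sqrtNegOneInvUnitχ p hp : (↥(ThetaSetting.modelχ p).Kdd)ˣ) : (ThetaSetting.modelχ p).Kdd) :
      PadicAlgCl p) = -(((c : (ThetaSetting.modelχ p).Kdd) : PadicAlgCl p) * sqrtNegOneχ p hp) := by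
    push_cast; rw [coe_sqrtNegOneInvUnitχ, sqrtNegOneχ_inv, mul_neg]
  constructor
  · rintro ⟨y, hy, m, hm, -, hpm⟩
    rcases hy with rfl | rfl
    · rw [valuesAt_testClass_anchored_tau, Set.mem_singleton_iff] at hm
      rw [hm, hcoe] at hpm
      exact hpm
    · rw [valuesAt_testClass_anchored_tauInv, Set.mem_singleton_iff] at hm
      rw [hm, hcoe', neg_eq_iff_eq_neg, neg_eq_iff_eq_neg, neg_neg] at hpm
      exact hpm.symm
  · intro h
    refine ⟨_, Or.inl rfl, c * sqrtNegOneUnitχ p hp, ?_, ?_, ?_⟩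
    · rw [valuesAt_testClass_anchored_tau]; exact Set.mem_singleton _
    · intro w hw
      rw [valuesAt_testClass_anchored_tau, Set.mem_singleton_iff] at hw
      rw [hw]
    · rw [hcoe]; exact h

/-! ### F-0513 at the anchored datum: PROVED for every test class, NON-VACUOUSLY -/

/-- **F-0513 `Thm110iUnique` HOLDS at the ANCHORED Def. 1.9 datum of the χ-model for every test class `η̈_c`**
(`p ≡ 1 (mod 4)`, `ε_Z := a`, `E := etaleThetaDataχM η̈_c`, `S := (anchoredStandardDataχ hp η̈_c).toStandardData`):
if `η̈_c^{Θ,Z}` and `(u·η̈_c)^{Θ,Z} = η̈_{u·c}^{Θ,Z}` are both of standard type then `c·√−1 = ±1` and `u·c·√−1 = ±1`, so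
`u = ±1`. [cite: MochizukiEtTh2009, Thm 1.10 (i) p.29] -/
theorem thm110iUnique_modelχ_anchored (hp : p % 4 = 1) (c : (↥(ThetaSetting.modelχ p).Kdd)ˣ) :
    Thm110iUnique (M := MuTwoSetting.modelχ p) (MuTwoSetting.modelχ_compat p) (MuTwoSetting.modelχ_isAdmissibleEpsZ p)
      (etaleThetaDataχM p
        ((ThetaSetting.modelχ p).inflTheta (ThetaSetting.modelχ p).GtpYdd
            ((kummerDataχSec p).kumYdd ((kummerDataχSec p).toKddHat c)) *
          (ThetaSetting.modelχ p).inflTheta (ThetaSetting.modelχ p).GtpYdd (kummerDataχSec p).logUdd))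
      (anchoredStandardDataχ p hp
        ((ThetaSetting.modelχ p).inflTheta (ThetaSetting.modelχ p).GtpYdd
            ((kummerDataχSec p).kumYdd ((kummerDataχSec p).toKddHat c)) *
          (ThetaSetting.modelχ p).inflTheta (ThetaSetting.modelχ p).GtpYdd (kummerDataχSec p).logUdd)).toStandardData := by
  intro u _ h1 h2
  rw [MuTwoSetting.isOfStandardType_iff_exists_minimal] at h1 h2
  obtain ⟨y₁, hy₁, m₁, hm₁, -, hpm₁⟩ := h1
  obtain ⟨y₂, hy₂, m₂, hm₂, -, hpm₂⟩ := h2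
  have hinv := sqrtNegOneχ_inv p hp
  -- coercions of the four candidate minimal values
  have hcoe : ∀ d : (↥(ThetaSetting.modelχ p).Kdd)ˣ,
      (((d * sqrtNegOneUnitχ p hp : (↥(ThetaSetting.modelχ p).Kdd)ˣ) : (ThetaSetting.modelχ p).Kdd) : PadicAlgCl p) =
        ((d : (ThetaSetting.modelχ p).Kdd) : PadicAlgCl p) * sqrtNegOneχ p hp := fun d => by
    push_cast; rw [coe_sqrtNegOneUnitχ]
  have hcoe' : ∀ d : (↥(ThetaSetting.modelχ p).Kdd)ˣ,
      (((d * sqrtNegOneInvUnitχ p hp : (↥(ThetaSetting.modelχ p).Kdd)ˣ) : (ThetaSetting.modelχ p).Kdd) : PadicAlgCl p) =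
        -(((d : (ThetaSetting.modelχ p).Kdd) : PadicAlgCl p) * sqrtNegOneχ p hp) := fun d => by
    push_cast; rw [coe_sqrtNegOneInvUnitχ, hinv, mul_neg]
  have huc : (((u * c : (↥(ThetaSetting.modelχ p).Kdd)ˣ) : (ThetaSetting.modelχ p).Kdd) : PadicAlgCl p) =
      ((u : (ThetaSetting.modelχ p).Kdd) : PadicAlgCl p) * ((c : (ThetaSetting.modelχ p).Kdd) : PadicAlgCl p) := by
    push_cast; rfl
  -- (A) `η̈_c` standard ⇒ `c·√−1 = ±1`
  have hA : ((c : (ThetaSetting.modelχ p).Kdd) : PadicAlgCl p) * sqrtNegOneχ p hp = 1 ∨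
      ((c : (ThetaSetting.modelχ p).Kdd) : PadicAlgCl p) * sqrtNegOneχ p hp = -1 := by
    rcases hy₁ with rfl | rfl
    · have hm : m₁ ∈ ({c * sqrtNegOneUnitχ p hp} : Set (↥(ThetaSetting.modelχ p).Kdd)ˣ) := by
        rw [← valuesAt_testClass_anchored_tau p hp
          ((ThetaSetting.modelχ p).inflTheta (ThetaSetting.modelχ p).GtpYdd
              ((kummerDataχSec p).kumYdd ((kummerDataχSec p).toKddHat c)) *
            (ThetaSetting.modelχ p).inflTheta (ThetaSetting.modelχ p).GtpYdd (kummerDataχSec p).logUdd) c]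
        exact hm₁
      rw [Set.mem_singleton_iff] at hm
      rw [hm, hcoe] at hpm₁
      exact hpm₁
    · have hm : m₁ ∈ ({c * sqrtNegOneInvUnitχ p hp} : Set (↥(ThetaSetting.modelχ p).Kdd)ˣ) := by
        rw [← valuesAt_testClass_anchored_tauInv p hp
          ((ThetaSetting.modelχ p).inflTheta (ThetaSetting.modelχ p).GtpYdd
              ((kummerDataχSec p).kumYdd ((kummerDataχSec p).toKddHat c)) *
            (ThetaSetting.modelχ p).inflTheta (ThetaSetting.modelχ p).GtpYdd (kummerDataχSec p).logUdd) c]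
        exact hm₁
      rw [Set.mem_singleton_iff] at hm
      rw [hm, hcoe', neg_eq_iff_eq_neg, neg_eq_iff_eq_neg, neg_neg] at hpm₁
      exact hpm₁.symm
  -- (B) `(u·η̈_c) = η̈_{u·c}` standard ⇒ `u·c·√−1 = ±1`
  have hB : ((u : (ThetaSetting.modelχ p).Kdd) : PadicAlgCl p) *
        (((c : (ThetaSetting.modelχ p).Kdd) : PadicAlgCl p) * sqrtNegOneχ p hp) = 1 ∨
      ((u : (ThetaSetting.modelχ p).Kdd) : PadicAlgCl p) *
        (((c : (ThetaSetting.modelχ p).Kdd) : PadicAlgCl p) * sqrtNegOneχ p hp) = -1 := by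
    rw [← mul_assoc, ← huc]
    rcases hy₂ with rfl | rfl
    · have hm : m₂ ∈ ({u * c * sqrtNegOneUnitχ p hp} : Set (↥(ThetaSetting.modelχ p).Kdd)ˣ) := by
        rw [← valuesAt_testClass_anchored_tau p hp
          ((ThetaSetting.modelχ p).inflTheta (ThetaSetting.modelχ p).GtpYdd
              ((kummerDataχSec p).kumYdd ((kummerDataχSec p).toKddHat c)) *
            (ThetaSetting.modelχ p).inflTheta (ThetaSetting.modelχ p).GtpYdd (kummerDataχSec p).logUdd) (u * c),
          ← kumInfl_mul_testClass]
        exact hm₂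
      rw [Set.mem_singleton_iff] at hm
      rw [hm, hcoe] at hpm₂
      exact hpm₂
    · have hm : m₂ ∈ ({u * c * sqrtNegOneInvUnitχ p hp} : Set (↥(ThetaSetting.modelχ p).Kdd)ˣ) := by
        rw [← valuesAt_testClass_anchored_tauInv p hp
          ((ThetaSetting.modelχ p).inflTheta (ThetaSetting.modelχ p).GtpYdd
              ((kummerDataχSec p).kumYdd ((kummerDataχSec p).toKddHat c)) *
            (ThetaSetting.modelχ p).inflTheta (ThetaSetting.modelχ p).GtpYdd (kummerDataχSec p).logUdd) (u * c),
          ← kumInfl_mul_testClass]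
        exact hm₂
      rw [Set.mem_singleton_iff] at hm
      rw [hm, hcoe', neg_eq_iff_eq_neg, neg_eq_iff_eq_neg, neg_neg] at hpm₂
      exact hpm₂.symm
  -- (C) field arithmetic: `u = ±1`
  rcases hA with hA | hA <;> rw [hA] at hB <;> rcases hB with hB | hB
  · exact Or.inl (by rw [mul_one] at hB; exact hB)
  · exact Or.inr (by rw [mul_one] at hB; exact hB)
  · exact Or.inr (by rw [mul_neg_one, neg_eq_iff_eq_neg] at hB; exact hB)
  · exact Or.inl (by rw [mul_neg_one, neg_inj] at hB; exact hB)

/-- **NON-VACUITY**: for `c := (√−1)⁻¹` the test class `η̈_c` IS of standard type at the anchored datum (its value at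
`τ` is `(√−1)⁻¹·√−1 = 1`). [cite: MochizukiEtTh2009, Def 1.9 (ii) p.29] -/
theorem isOfStandardType_testClass_anchored (hp : p % 4 = 1)
    (η : (ThetaSetting.modelχ p).H1 (ThetaSetting.modelχ p).GtpYdd) :
    MuTwoSetting.IsOfStandardType (M := MuTwoSetting.modelχ p) (MuTwoSetting.modelχ_compat p) (epsZχ p)
      (anchoredStandardDataχ p hp η).toStandardData
      ((ThetaSetting.modelχ p).inflTheta (ThetaSetting.modelχ p).GtpYdd
          ((kummerDataχSec p).kumYdd ((kummerDataχSec p).toKddHat (sqrtNegOneInvUnitχ p hp))) *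
        (ThetaSetting.modelχ p).inflTheta (ThetaSetting.modelχ p).GtpYdd (kummerDataχSec p).logUdd) := by
  rw [MuTwoSetting.isOfStandardType_iff_exists_minimal, exists_minimal_testClass_anchored_iff, coe_sqrtNegOneInvUnitχ,
    inv_mul_cancel₀ (sqrtNegOneχ_ne_zero p hp)]
  exact Or.inl rfl

/-- **Census headline — F-0513's instance form is INHABITED, NON-VACUOUSLY, at a Kummer-carrying model.** For
`p ≡ 1 (mod 4)` there are a Def. 1.7 setting `M` satisfying the guard `IsEtThOrigin`, an admissible `ε_Z`,
`hC : Compat`, étale-theta data `E` whose class `η̈^Θ` IS OF STANDARD TYPE at an ANCHORED standard datum `A`, such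
that `Thm110iUnique hC hZ E A.toStandardData` holds — witness the χ-model with `η̈ := infl κ̈((√−1)⁻¹)·infl log(Ü)`.
(Contrast `not_forall_thm110iUnique`: over FREE standard data the closure fails at the same model.)
[cite: MochizukiEtTh2009, Thm 1.10 (i) p.29] -/
theorem _root_.Literature.AnabelianGeometry.EtaleTheta.MuTwoSetting.exists_kummer_model_thm110iUnique (hp : p % 4 = 1) :
    ∃ (M : MuTwoSetting p) (εZ : M.GtpC) (hZ : M.IsAdmissibleEpsZ εZ) (hC : M.toThetaSetting.Compat)
      (E : M.toThetaSetting.EtaleThetaData) (A : M.AnchoredStandardData E.toKummerData),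
      M.toThetaSetting.IsEtThOrigin ∧ Nonempty M.toThetaSetting.KummerData ∧
        M.IsOfStandardType hC εZ A.toStandardData E.etaDd ∧ Thm110iUnique hC hZ E A.toStandardData :=
  ⟨MuTwoSetting.modelχ p, epsZχ p, MuTwoSetting.modelχ_isAdmissibleEpsZ p, MuTwoSetting.modelχ_compat p,
    etaleThetaDataχM p _, anchoredStandardDataχ p hp _, MuTwoSetting.modelχ_isEtThOrigin p, nonempty_kummerData_modelχ p,
    isOfStandardType_testClass_anchored p hp _, thm110iUnique_modelχ_anchored p hp (sqrtNegOneInvUnitχ p hp)⟩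

end Literature.AnabelianGeometry.EtaleTheta.SettingModel

end
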